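import Mathlib
import Summits.NavierStokesRegularity.NavierStokesRegularity.Theorems.TaoLadderRungTwoBreakBlowupRigidityOneMixedDrainPairIdentities
import Summits.NavierStokesRegularity.NavierStokesRegularity.Theorems.TaoLadderRungTwoBreakBlowupRigidityOneMixedDrainPairOrthant
import HarnessLib

/-!
# SIGN-FREE TRANSMISSION LAW of the mixed-drain pair `M(u,v)`: along ANY exact inviscid flow from a one-shell datum the
  energy transmitted past shell `n ≥ 1` is at most the SQUARE of `Λ^n ×` the time-integrated wake energy of shell `n`,
  `√(D_n(t)² + E_{>n}(t)) ≤ 2|u/v|√(u²+v²) Λ^n ∫₀ᵗ b_n²` — no sign hypotheses (compare the orthant wake floor of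
  `…MixedDrainPairWake`); consequence under robust blow-up: EVERY WAKE IS LOADED before the next shell fires
  (census item (MP) of K2(1) `TaoLadderRungTwoBreak.BlowupRigidityOne`, stmt-NavierStokesRegularity-20206; `--supports`)

MODEL lattice ODEs only (Tao 2016 §4 (4.3), Lemma 4.1 (4.5)–(4.10), Thm. 4.2 statement shape); nothing here is a
statement about the Navier–Stokes equations; NO item is closed.  DEF-FREE; ROUTE-INDEPENDENT MODULE (no `Theses` import).

THE ESTIMATE.  With `D_n = (u/v) b_n − a_n` (drain defect), `S_n = Σ_{j ≤ n} ‖x_j‖²`, `E₀ = Σ_i X₀ᵢ²`, `G_{n+1} = u a_{n+1} +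
v b_{n+1}`, the identities `Ḋ_n = 2Λ^n b_n G_{n+1}`, `Ṡ_n = −4Λ^n a_n b_n G_{n+1}` of `…MixedDrainPairIdentities` combine to
`d/dt (D_n² + (E₀ − S_n)) = 4(u/v) Λ^n b_n² G_{n+1}` (the drain defect absorbs `a_n`: `D_n + a_n = (u/v) b_n`), while the
energy bound `S_{n+1} ≤ E₀` (`partialEnergy_le_datumEnergy`) gives `|G_{n+1}| ≤ √(u²+v²) ‖x_{n+1}‖ ≤ √(u²+v²) √(E₀ − S_n)`.
Hence `Ψ = D_n² + (E₀ − S_n) ≥ 0` obeys `Ψ' ≤ 4|u/v|√(u²+v²) Λ^n b_n² √Ψ`, `Ψ(0) = 0`, and the square-root comparison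
lemma (Bihari type; monotonicity of `J/2 − √(Ψ + δ²)`) yields the law.  SHARP at early times (the leading Taylor term of
`‖x_{n+1}‖` attains it), scale-critical, sign-free: «no wake, no transmission» — an AC transmission must first load `b_n`.

* `le_of_hasDerivWithinAt_Ici_nonneg` — monotonicity tool on `[0,t] ⊂ [0,T)` for one-sided derivatives within `[0,∞)`;
* `sqrt_le_half_primitive_of_deriv_le` — `Ψ ≥ 0`, `Ψ(0) = 0`, `Ψ' ≤ w √Ψ`, `J' = w ≥ 0` ⇒ `√Ψ(t) ≤ (J(t) − J(0))/2`;
* `hasDerivWithinAt_primitive_of_continuousOn_Ico` — FTC: `t ↦ ∫₀ᵗ f` has one-sided derivative `f` within `[0,∞)` on `[0,T)`;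
* `sqrt_defectEnergy_le_wakePrimitive_mixedDrainPair` — the law for any primitive `J` of `b_n²`;
* `sqrt_tailEnergy_le_wakeIntegral_mixedDrainPair`, `norm_shellVec_succ_le_wakeIntegral_mixedDrainPair` — the law with
  `J = ∫₀ᵗ b_n²`: `√(E₀ − S_n(t))`, `‖x_{n+1}(t)‖ ≤ 2|u/v|√(u²+v²) Λ^n ∫₀ᵗ b_n²`;
* `wakeLedger_of_noGlobalCascade_mixedDrainPair` — under `NoGlobalCascade ε₀ M(u,v) X₀` (`0 < |u|,|v| ≤ 1`), along the
  maximal exact flow («every shell fires», `everyShellFires_of_noGlobalCascade`) every shell `k ≥ 1` satisfies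
  `1 < C_A T Λ^{k+2} · 2|u/v|√(u²+v²) Λ^k ∫₀ᵗ b_k²` at some `t < T`: the time-integrated wake energy of shell `k` before
  shell `k+1` fires is `≥ c(u,v) T⁻¹ Λ^{−2k−2}`.

HONEST LABEL: an a-priori estimate and a necessary condition for robust blow-up on one explicit table family; (MP) is NOT
decided; no stub, crux, rung or summit is proved; rung 0.
-/

noncomputable section

-- the summit and its single sub-problem share the name (CONVENTIONS §1)
set_option linter.dupNamespace false

open Set Filter Topology MeasureTheory
open scoped RealInnerProductSpace

namespace Summit.NavierStokesRegularity.NavierStokesRegularity.Theorems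

namespace BlowupRigidityOne

open Literature.Analysis.FluidPDE Literature.Analysis.FluidPDE.TaoCascade

/-! ## Two real-variable tools -/

/-- Monotonicity on `[0,t] ⊂ [0,T)` from a non-negative one-sided derivative within `[0,∞)`: `φ(0) ≤ φ(τ)`. [folklore] -/
theorem le_of_hasDerivWithinAt_Ici_nonneg {φ φ' : ℝ → ℝ} {T t : ℝ} (ht : t ∈ Ico 0 T)
    (hφ : ∀ τ ∈ Ico 0 T, HasDerivWithinAt φ (φ' τ) (Ici 0) τ) (hφ' : ∀ τ ∈ Icc 0 t, 0 ≤ φ' τ) :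
    ∀ τ ∈ Icc 0 t, φ 0 ≤ φ τ := by
  intro τ hτ
  have hsub : Icc (0 : ℝ) t ⊆ Ico 0 T := fun s hs => ⟨hs.1, lt_of_le_of_lt hs.2 ht.2⟩
  have hcont : ContinuousOn φ (Icc 0 t) := fun s hs =>
    ((hφ s (hsub hs)).continuousWithinAt).mono Icc_subset_Ici_self
  have hmon : MonotoneOn φ (Icc 0 t) := by
    refine monotoneOn_of_hasDerivWithinAt_nonneg (convex_Icc 0 t) hcont (f' := φ') ?_ ?_
    · intro s hs
      rw [interior_Icc] at hs
      have hsT : s ∈ Ico (0 : ℝ) T := ⟨hs.1.le, lt_trans hs.2 ht.2⟩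
      exact ((hφ s hsT).hasDerivAt (Ici_mem_nhds hs.1)).hasDerivWithinAt
    · intro s hs
      rw [interior_Icc] at hs
      exact hφ' s ⟨hs.1.le, hs.2.le⟩
  exact hmon (left_mem_Icc.2 ht.1) hτ hτ.1

/-- **Square-root comparison (Bihari-type).**  If `Ψ ≥ 0` on `[0,T)` with `Ψ(0) = 0` and one-sided derivative `Ψ'`, `J` has
one-sided derivative `w ≥ 0`, and `Ψ' ≤ w √Ψ` on `[0,t]`, then `√Ψ(t) ≤ (J(t) − J(0))/2`: the function `J/2 − √(Ψ + δ²)` is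
non-decreasing for every `δ > 0`. [folklore] -/
theorem sqrt_le_half_primitive_of_deriv_le {Ψ Ψ' w J : ℝ → ℝ} {T t : ℝ} (ht : t ∈ Ico 0 T)
    (hΨ : ∀ τ ∈ Ico 0 T, HasDerivWithinAt Ψ (Ψ' τ) (Ici 0) τ) (hΨnn : ∀ τ ∈ Ico 0 T, 0 ≤ Ψ τ) (hΨ0 : Ψ 0 = 0)
    (hJ : ∀ τ ∈ Ico 0 T, HasDerivWithinAt J (w τ) (Ici 0) τ)
    (hle : ∀ τ ∈ Icc 0 t, Ψ' τ ≤ w τ * Real.sqrt (Ψ τ)) (hw : ∀ τ ∈ Icc 0 t, 0 ≤ w τ) :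
    Real.sqrt (Ψ t) ≤ (J t - J 0) / 2 := by
  refine le_of_forall_pos_le_add fun δ hδ => ?_
  have hφ : ∀ τ ∈ Ico (0 : ℝ) T, HasDerivWithinAt (fun s => J s / 2 - Real.sqrt (Ψ s + δ ^ 2))
      (w τ / 2 - Ψ' τ / (2 * Real.sqrt (Ψ τ + δ ^ 2))) (Ici 0) τ := by
    intro τ hτ
    have hpos : Ψ τ + δ ^ 2 ≠ 0 := by have := hΨnn τ hτ; positivity
    exact ((hJ τ hτ).div_const 2).sub (((hΨ τ hτ).add_const (δ ^ 2)).sqrt hpos)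
  have hφ' : ∀ τ ∈ Icc (0 : ℝ) t, 0 ≤ w τ / 2 - Ψ' τ / (2 * Real.sqrt (Ψ τ + δ ^ 2)) := by
    intro τ hτ
    have hτT : τ ∈ Ico (0 : ℝ) T := ⟨hτ.1, lt_of_le_of_lt hτ.2 ht.2⟩
    have hΨτ := hΨnn τ hτT
    have hs : 0 < Real.sqrt (Ψ τ + δ ^ 2) := Real.sqrt_pos.2 (by positivity)
    have h1 : Real.sqrt (Ψ τ) ≤ Real.sqrt (Ψ τ + δ ^ 2) := Real.sqrt_le_sqrt (by nlinarith)
    have h2 : Ψ' τ ≤ w τ * Real.sqrt (Ψ τ + δ ^ 2) :=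
      (hle τ hτ).trans (mul_le_mul_of_nonneg_left h1 (hw τ hτ))
    rw [sub_nonneg, div_le_iff₀ (by positivity)]
    calc Ψ' τ ≤ w τ * Real.sqrt (Ψ τ + δ ^ 2) := h2
      _ = w τ / 2 * (2 * Real.sqrt (Ψ τ + δ ^ 2)) := by ring
  have h := le_of_hasDerivWithinAt_Ici_nonneg ht hφ hφ' t ⟨ht.1, le_rfl⟩
  simp only [hΨ0, zero_add] at h
  rw [Real.sqrt_sq hδ.le] at h
  have h3 : Real.sqrt (Ψ t) ≤ Real.sqrt (Ψ t + δ ^ 2) :=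
    Real.sqrt_le_sqrt (by nlinarith [hΨnn t ht])
  linarith

/-- **FTC within `[0,∞)`**: for `f` continuous on `[0,T)`, the primitive `t ↦ ∫₀ᵗ f` has one-sided derivative `f(τ)` within
`[0,∞)` at every `τ ∈ [0,T)`. [folklore] -/
theorem hasDerivWithinAt_primitive_of_continuousOn_Ico {f : ℝ → ℝ} {T : ℝ} (hf : ContinuousOn f (Ico 0 T)) :
    ∀ τ ∈ Ico 0 T, HasDerivWithinAt (fun t => ∫ s in (0 : ℝ)..t, f s) (f τ) (Ici 0) τ := by
  intro τ hτ
  have hT : 0 < T := lt_of_le_of_lt hτ.1 hτ.2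
  have hint : IntervalIntegrable f volume 0 τ :=
    (hf.mono fun s hs => ⟨hs.1, lt_of_le_of_lt hs.2 hτ.2⟩).intervalIntegrable_of_Icc hτ.1
  have hmeasIoo : AEStronglyMeasurable f (volume.restrict (Ioo 0 T)) :=
    (hf.mono Ioo_subset_Ico_self).aestronglyMeasurable measurableSet_Ioo
  rcases eq_or_lt_of_le hτ.1 with h0 | h0
  · subst h0
    have hIoo : Ioo (0 : ℝ) T ∈ 𝓝[>] (0 : ℝ) :=
      mem_nhdsWithin.2 ⟨Iio T, isOpen_Iio, hT, fun x hx => ⟨hx.2, hx.1⟩⟩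
    have hmeas : StronglyMeasurableAtFilter f (𝓝[>] (0 : ℝ)) volume := ⟨Ioo 0 T, hIoo, hmeasIoo⟩
    have hcont : ContinuousWithinAt f (Ioi 0) 0 :=
      (hf 0 hτ).mono_of_mem_nhdsWithin
        (mem_nhdsWithin.2 ⟨Iio T, isOpen_Iio, hT, fun x hx => ⟨le_of_lt hx.2, hx.1⟩⟩)
    exact intervalIntegral.integral_hasDerivWithinAt_right hint hmeas hcont
  · have hτI : τ ∈ Ioo (0 : ℝ) T := ⟨h0, hτ.2⟩
    have hmeas : StronglyMeasurableAtFilter f (𝓝 τ) volume :=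
      ContinuousOn.stronglyMeasurableAtFilter isOpen_Ioo (hf.mono Ioo_subset_Ico_self) τ hτI
    have hcont : ContinuousAt f τ := (hf.mono Ioo_subset_Ico_self).continuousAt (Ioo_mem_nhds h0 hτ.2)
    exact (intervalIntegral.integral_hasDerivAt_right hint hmeas hcont).hasDerivWithinAt

/-! ## The transmission law -/

/-- **SIGN-FREE TRANSMISSION LAW (primitive form).**  Exact inviscid flow of `M(u,v)` (`v ≠ 0`) from a one-shell datum at shell
`0`, (4.5)-regular on every `[0,T']`, `T' < T`; `n ≥ 1`; `J` any function with one-sided derivative `b_n²` on `[0,T)`.  Then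
for every `t < T`:
`√( ((u/v) b_n(t) − a_n(t))² + (Σ_i X₀ᵢ² − Σ_{j ≤ n} ‖x_j(t)‖²) ) ≤ 2 |u/v| √(u²+v²) Λ^n (J(t) − J(0))`.
[cite: Tao2016AveragedNS, §4 (4.3), Lemma 4.1 (4.5), (4.8)–(4.10) (shell energy balance); cell vocabulary (census item (MP))] -/
theorem sqrt_defectEnergy_le_wakePrimitive_mixedDrainPair {u v ε₀ T : ℝ} (hv : v ≠ 0) (hε : 0 < ε₀)
    {X : Fin 4 → ℤ → ℝ → ℝ} {X₀ : Fin 4 → ℝ}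
    (hder : ∀ i k, ∀ t ∈ Ico 0 T, HasDerivWithinAt (X i k) (quadTerm ε₀ (fun (i₁ i₂ i₃ : Fin 4) (μ : ℤ × ℤ × ℤ) => if μ = ((0 : ℤ), (0 : ℤ), (1 : ℤ)) then
        (if (i₁ = 0 ∧ i₂ = 1) ∨ (i₁ = 1 ∧ i₂ = 0) then (if i₃ = 0 then u else if i₃ = 1 then v else 0) else 0)
      else if μ = ((1 : ℤ), (0 : ℤ), (0 : ℤ)) then
        (if i₁ = 0 ∧ i₂ = 1 ∧ i₃ = 0 then -u else if i₁ = 1 ∧ i₂ = 1 ∧ i₃ = 0 then -v else 0)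
      else if μ = ((0 : ℤ), (1 : ℤ), (0 : ℤ)) then
        (if i₁ = 1 ∧ i₂ = 0 ∧ i₃ = 0 then -u else if i₁ = 1 ∧ i₂ = 1 ∧ i₃ = 0 then -v else 0) else 0) X i k t) (Ici 0) t)
    (hinit : ∀ i k, X i k 0 = if k = 0 then X₀ i else 0)
    (hlow : ∀ i k t, k < 0 → X i k t = 0)
    (hreg : ∀ T' : ℝ, T' < T → ∃ M : ℝ, ∀ t ∈ Icc 0 T', ∀ (i : Fin 4) (k : ℤ),
      (1 + (1 + ε₀) ^ ((10 : ℝ) * k)) * |X i k t| ≤ M)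
    {n : ℕ} (hn : 1 ≤ n) {J : ℝ → ℝ} (hJ : ∀ τ ∈ Ico 0 T, HasDerivWithinAt J (X 1 n τ ^ 2) (Ici 0) τ)
    {t : ℝ} (ht : t ∈ Ico 0 T) :
    Real.sqrt ((u / v * X 1 n t - X 0 n t) ^ 2 +
        ((∑ i, X₀ i ^ 2) - ∑ j ∈ Finset.range (n + 1), ‖shellVec X (j : ℤ) t‖ ^ 2)) ≤
      2 * |u / v| * Real.sqrt (u ^ 2 + v ^ 2) * bigLam ε₀ ^ (n : ℤ) * (J t - J 0) := by
  have hL : 0 < bigLam ε₀ := bigLam_pos (by linarith)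
  have hc := isCancellingCoeff_mixedDrainPair u v
  have hE := partialEnergy_le_datumEnergy hε hc hder hinit hlow hreg
  set Ln : ℝ := bigLam ε₀ ^ (n : ℤ) with hLn
  have hLn0 : 0 < Ln := zpow_pos hL _
  set E₀ : ℝ := ∑ i, X₀ i ^ 2 with hE₀
  set G : ℝ → ℝ := fun τ => u * X 0 ((n : ℤ) + 1) τ + v * X 1 ((n : ℤ) + 1) τ with hG
  set Ψ : ℝ → ℝ := fun s => (u / v * X 1 n s - X 0 n s) ^ 2 +
    (E₀ - ∑ j ∈ Finset.range (n + 1), ‖shellVec X (j : ℤ) s‖ ^ 2) with hΨdef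
  -- the derivative of `Ψ`
  have hΨder : ∀ τ ∈ Ico (0 : ℝ) T,
      HasDerivWithinAt Ψ (4 * (u / v) * Ln * X 1 n τ ^ 2 * G τ) (Ici 0) τ := by
    intro τ hτ
    have hD := hasDerivWithinAt_drainDefect_mixedDrainPair hv hε hder (n : ℤ) hτ
    have hS := hasDerivWithinAt_partialEnergy_mixedDrainPair hε hder hlow n hτ
    have h := (hD.pow 2).add (hS.const_sub E₀)
    refine h.congr_deriv ?_
    simp only [hG, hLn]
    push_cast
    ring
  -- non-negativity and the bound on the drain rate
  have he : ∀ τ ∈ Ico (0 : ℝ) T, 0 ≤ E₀ - ∑ j ∈ Finset.range (n + 1), ‖shellVec X (j : ℤ) τ‖ ^ 2 :=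
    fun τ hτ => sub_nonneg.2 (hE τ hτ n)
  have hx : ∀ τ ∈ Ico (0 : ℝ) T, ‖shellVec X ((n : ℤ) + 1) τ‖ ^ 2 ≤
      E₀ - ∑ j ∈ Finset.range (n + 1), ‖shellVec X (j : ℤ) τ‖ ^ 2 := by
    intro τ hτ
    have h := hE τ hτ (n + 1)
    rw [Finset.sum_range_succ] at h
    push_cast at h
    linarith
  have hΨnn : ∀ τ ∈ Ico (0 : ℝ) T, 0 ≤ Ψ τ := fun τ hτ => add_nonneg (sq_nonneg _) (he τ hτ)
  have hGle : ∀ τ ∈ Ico (0 : ℝ) T, |G τ| ≤ Real.sqrt (u ^ 2 + v ^ 2) * Real.sqrt (Ψ τ) := by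
    intro τ hτ
    have hab := sq_add_sq_le_norm_sq_shellVec X ((n : ℤ) + 1) τ
    have hG2 : G τ ^ 2 ≤ (u ^ 2 + v ^ 2) * Ψ τ := by
      have h1 : G τ ^ 2 ≤ (u ^ 2 + v ^ 2) * (X 0 ((n : ℤ) + 1) τ ^ 2 + X 1 ((n : ℤ) + 1) τ ^ 2) := by
        simp only [hG]
        nlinarith [sq_nonneg (u * X 1 ((n : ℤ) + 1) τ - v * X 0 ((n : ℤ) + 1) τ)]
      have h2 : X 0 ((n : ℤ) + 1) τ ^ 2 + X 1 ((n : ℤ) + 1) τ ^ 2 ≤ Ψ τ := by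
        have := hx τ hτ
        have h3 : 0 ≤ (u / v * X 1 n τ - X 0 n τ) ^ 2 := sq_nonneg _
        simp only [hΨdef]
        linarith
      exact h1.trans (mul_le_mul_of_nonneg_left h2 (by positivity))
    calc |G τ| ≤ Real.sqrt ((u ^ 2 + v ^ 2) * Ψ τ) := Real.abs_le_sqrt hG2
      _ = Real.sqrt (u ^ 2 + v ^ 2) * Real.sqrt (Ψ τ) := Real.sqrt_mul (by positivity) _
  have hle : ∀ τ ∈ Icc (0 : ℝ) t, 4 * (u / v) * Ln * X 1 n τ ^ 2 * G τ ≤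
      (4 * |u / v| * Real.sqrt (u ^ 2 + v ^ 2) * Ln * X 1 n τ ^ 2) * Real.sqrt (Ψ τ) := by
    intro τ hτ
    have hτT : τ ∈ Ico (0 : ℝ) T := ⟨hτ.1, lt_of_le_of_lt hτ.2 ht.2⟩
    have h1 : u / v * G τ ≤ |u / v| * |G τ| := by rw [← abs_mul]; exact le_abs_self _
    have h2 : |u / v| * |G τ| ≤ |u / v| * (Real.sqrt (u ^ 2 + v ^ 2) * Real.sqrt (Ψ τ)) :=
      mul_le_mul_of_nonneg_left (hGle τ hτT) (abs_nonneg _)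
    have h3 : 0 ≤ 4 * Ln * X 1 n τ ^ 2 := by positivity
    calc 4 * (u / v) * Ln * X 1 n τ ^ 2 * G τ = (4 * Ln * X 1 n τ ^ 2) * (u / v * G τ) := by ring
      _ ≤ (4 * Ln * X 1 n τ ^ 2) * (|u / v| * (Real.sqrt (u ^ 2 + v ^ 2) * Real.sqrt (Ψ τ))) :=
          mul_le_mul_of_nonneg_left (h1.trans h2) h3
      _ = (4 * |u / v| * Real.sqrt (u ^ 2 + v ^ 2) * Ln * X 1 n τ ^ 2) * Real.sqrt (Ψ τ) := by ring
  -- initial value `Ψ(0) = 0`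
  have hn0 : (n : ℤ) ≠ 0 := by exact_mod_cast (by omega : n ≠ 0)
  have hΨ0 : Ψ 0 = 0 := by
    have ha0 : X 0 n 0 = 0 := by rw [hinit, if_neg hn0]
    have hb0 : X 1 n 0 = 0 := by rw [hinit, if_neg hn0]
    have hS0 : ∑ j ∈ Finset.range (n + 1), ‖shellVec X (j : ℤ) 0‖ ^ 2 = E₀ := by
      rw [Finset.sum_eq_single 0]
      · rw [EuclideanSpace.norm_eq, Real.sq_sqrt (Finset.sum_nonneg fun i _ => by positivity)]
        refine Finset.sum_congr rfl fun i _ => ?_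
        simp [shellVec, hinit]
      · intro j _ hj
        have : shellVec X (j : ℤ) 0 = 0 := by
          ext i
          simp [shellVec, hinit, hj]
        rw [this, norm_zero, zero_pow two_ne_zero]
      · intro h; exact absurd (Finset.mem_range.2 (Nat.succ_pos n)) h
    simp only [hΨdef, ha0, hb0, hS0]
    ring
  -- the square-root comparison with the primitive `c • J`
  set c : ℝ := 4 * |u / v| * Real.sqrt (u ^ 2 + v ^ 2) * Ln with hcdef
  have hJ' : ∀ τ ∈ Ico (0 : ℝ) T, HasDerivWithinAt (fun s => c * J s) (c * X 1 n τ ^ 2) (Ici 0) τ :=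
    fun τ hτ => (hJ τ hτ).const_mul c
  have hmain := sqrt_le_half_primitive_of_deriv_le (Ψ := Ψ) (w := fun τ => c * X 1 n τ ^ 2) ht hΨder hΨnn hΨ0 hJ'
    (fun τ hτ => by
      have := hle τ hτ
      simp only [hcdef]
      calc 4 * (u / v) * Ln * X 1 n τ ^ 2 * G τ
          ≤ (4 * |u / v| * Real.sqrt (u ^ 2 + v ^ 2) * Ln * X 1 n τ ^ 2) * Real.sqrt (Ψ τ) := this
        _ = 4 * |u / v| * Real.sqrt (u ^ 2 + v ^ 2) * Ln * X 1 n τ ^ 2 * Real.sqrt (Ψ τ) := by ring)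
    (fun τ _ => by positivity)
  calc Real.sqrt (Ψ t) ≤ (c * J t - c * J 0) / 2 := hmain
    _ = 2 * |u / v| * Real.sqrt (u ^ 2 + v ^ 2) * Ln * (J t - J 0) := by simp only [hcdef]; ring

/-- **SIGN-FREE TRANSMISSION LAW**: along an exact inviscid flow of `M(u,v)` (`v ≠ 0`) from a one-shell datum at shell `0`,
for every `n ≥ 1` and `t < T`, `√(Σ_i X₀ᵢ² − Σ_{j ≤ n} ‖x_j(t)‖²) ≤ 2 |u/v| √(u²+v²) Λ^n ∫₀ᵗ b_n(s)² ds` — the energy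
transmitted past shell `n` is at most the square of `Λ^n ×` the time-integrated wake energy of shell `n`.
[cite: Tao2016AveragedNS, §4 (4.3), Lemma 4.1 (4.5), (4.8)–(4.10); cell vocabulary (census item (MP))] -/
theorem sqrt_tailEnergy_le_wakeIntegral_mixedDrainPair {u v ε₀ T : ℝ} (hv : v ≠ 0) (hε : 0 < ε₀)
    {X : Fin 4 → ℤ → ℝ → ℝ} {X₀ : Fin 4 → ℝ}
    (hder : ∀ i k, ∀ t ∈ Ico 0 T, HasDerivWithinAt (X i k) (quadTerm ε₀ (fun (i₁ i₂ i₃ : Fin 4) (μ : ℤ × ℤ × ℤ) => if μ = ((0 : ℤ), (0 : ℤ), (1 : ℤ)) then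
        (if (i₁ = 0 ∧ i₂ = 1) ∨ (i₁ = 1 ∧ i₂ = 0) then (if i₃ = 0 then u else if i₃ = 1 then v else 0) else 0)
      else if μ = ((1 : ℤ), (0 : ℤ), (0 : ℤ)) then
        (if i₁ = 0 ∧ i₂ = 1 ∧ i₃ = 0 then -u else if i₁ = 1 ∧ i₂ = 1 ∧ i₃ = 0 then -v else 0)
      else if μ = ((0 : ℤ), (1 : ℤ), (0 : ℤ)) then
        (if i₁ = 1 ∧ i₂ = 0 ∧ i₃ = 0 then -u else if i₁ = 1 ∧ i₂ = 1 ∧ i₃ = 0 then -v else 0) else 0) X i k t) (Ici 0) t)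
    (hinit : ∀ i k, X i k 0 = if k = 0 then X₀ i else 0)
    (hlow : ∀ i k t, k < 0 → X i k t = 0)
    (hreg : ∀ T' : ℝ, T' < T → ∃ M : ℝ, ∀ t ∈ Icc 0 T', ∀ (i : Fin 4) (k : ℤ),
      (1 + (1 + ε₀) ^ ((10 : ℝ) * k)) * |X i k t| ≤ M)
    {n : ℕ} (hn : 1 ≤ n) {t : ℝ} (ht : t ∈ Ico 0 T) :
    Real.sqrt ((∑ i, X₀ i ^ 2) - ∑ j ∈ Finset.range (n + 1), ‖shellVec X (j : ℤ) t‖ ^ 2) ≤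
      2 * |u / v| * Real.sqrt (u ^ 2 + v ^ 2) * bigLam ε₀ ^ (n : ℤ) * ∫ s in (0 : ℝ)..t, X 1 n s ^ 2 := by
  have hcont0 : ContinuousOn (X 1 n) (Ico 0 T) := fun τ hτ =>
    ((hder 1 n τ hτ).continuousWithinAt).mono fun s hs => mem_Ici.2 hs.1
  have hcont : ContinuousOn (fun s => X 1 n s ^ 2) (Ico 0 T) := hcont0.pow 2
  have hJ := hasDerivWithinAt_primitive_of_continuousOn_Ico hcont
  have h := sqrt_defectEnergy_le_wakePrimitive_mixedDrainPair hv hε hder hinit hlow hreg hn hJ ht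
  rw [intervalIntegral.integral_same, sub_zero] at h
  refine le_trans (Real.sqrt_le_sqrt ?_) h
  nlinarith [sq_nonneg (u / v * X 1 n t - X 0 n t)]

/-- **The next shell's amplitude**: `‖x_{n+1}(t)‖ ≤ 2 |u/v| √(u²+v²) Λ^n ∫₀ᵗ b_n²` (`n ≥ 1`, `t < T`), by the energy bound
`S_{n+1} ≤ E₀`. [cite: Tao2016AveragedNS, §4 Lemma 4.1 (4.5), (4.9)–(4.10); cell vocabulary (census item (MP))] -/
theorem norm_shellVec_succ_le_wakeIntegral_mixedDrainPair {u v ε₀ T : ℝ} (hv : v ≠ 0) (hε : 0 < ε₀)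
    {X : Fin 4 → ℤ → ℝ → ℝ} {X₀ : Fin 4 → ℝ}
    (hder : ∀ i k, ∀ t ∈ Ico 0 T, HasDerivWithinAt (X i k) (quadTerm ε₀ (fun (i₁ i₂ i₃ : Fin 4) (μ : ℤ × ℤ × ℤ) => if μ = ((0 : ℤ), (0 : ℤ), (1 : ℤ)) then
        (if (i₁ = 0 ∧ i₂ = 1) ∨ (i₁ = 1 ∧ i₂ = 0) then (if i₃ = 0 then u else if i₃ = 1 then v else 0) else 0)
      else if μ = ((1 : ℤ), (0 : ℤ), (0 : ℤ)) then
        (if i₁ = 0 ∧ i₂ = 1 ∧ i₃ = 0 then -u else if i₁ = 1 ∧ i₂ = 1 ∧ i₃ = 0 then -v else 0)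
      else if μ = ((0 : ℤ), (1 : ℤ), (0 : ℤ)) then
        (if i₁ = 1 ∧ i₂ = 0 ∧ i₃ = 0 then -u else if i₁ = 1 ∧ i₂ = 1 ∧ i₃ = 0 then -v else 0) else 0) X i k t) (Ici 0) t)
    (hinit : ∀ i k, X i k 0 = if k = 0 then X₀ i else 0)
    (hlow : ∀ i k t, k < 0 → X i k t = 0)
    (hreg : ∀ T' : ℝ, T' < T → ∃ M : ℝ, ∀ t ∈ Icc 0 T', ∀ (i : Fin 4) (k : ℤ),
      (1 + (1 + ε₀) ^ ((10 : ℝ) * k)) * |X i k t| ≤ M)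
    {n : ℕ} (hn : 1 ≤ n) {t : ℝ} (ht : t ∈ Ico 0 T) :
    ‖shellVec X ((n : ℤ) + 1) t‖ ≤
      2 * |u / v| * Real.sqrt (u ^ 2 + v ^ 2) * bigLam ε₀ ^ (n : ℤ) * ∫ s in (0 : ℝ)..t, X 1 n s ^ 2 := by
  have h := sqrt_tailEnergy_le_wakeIntegral_mixedDrainPair hv hε hder hinit hlow hreg hn ht
  have hE := partialEnergy_le_datumEnergy hε (isCancellingCoeff_mixedDrainPair u v) hder hinit hlow hreg t ht (n + 1)
  rw [Finset.sum_range_succ] at hE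
  push_cast at hE
  refine le_trans ?_ h
  rw [← Real.sqrt_sq (norm_nonneg (shellVec X ((n : ℤ) + 1) t))]
  exact Real.sqrt_le_sqrt (by linarith)

/-! ## Under robust blow-up: every wake is loaded -/

/-- **EVERY WAKE IS LOADED under robust blow-up of `M(u,v)`** (`0 < |u|, |v| ≤ 1`, so `M(u,v) ∈ E₂(max |u|⁻¹ |v|⁻¹)`): if
`NoGlobalCascade ε₀ M(u,v) X₀`, then along the maximal exact flow from `X₀` at shell `0` (blow-up time `T`; every shell fires,
`everyShellFires_of_noGlobalCascade`) every shell `k ≥ 1` satisfies, at some time `t < T` (a firing time of shell `k+1`),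
`1 < C_A T Λ^{k+2} · 2|u/v|√(u²+v²) Λ^k ∫₀ᵗ b_k²` — the time-integrated wake energy of shell `k` before shell `k+1` fires
is at least `(2|u/v|√(u²+v²) C_A T)⁻¹ Λ^{−2k−2}`.  A necessary condition; nothing is claimed about whether `M(u,v)` blows up.
[cite: Tao2016AveragedNS, §4 Thm. 4.2 (statement shape), Lemma 4.1 (4.5)–(4.10); cell vocabulary (`NoGlobalCascade`, census item (MP))] -/
theorem wakeLedger_of_noGlobalCascade_mixedDrainPair {u v ε₀ : ℝ} (hu : 0 < |u|) (hu1 : |u| ≤ 1) (hv : 0 < |v|)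
    (hv1 : |v| ≤ 1) (hε : 0 < ε₀) {X₀ : Fin 4 → ℝ}
    (hNG : NoGlobalCascade ε₀ (fun (i₁ i₂ i₃ : Fin 4) (μ : ℤ × ℤ × ℤ) => if μ = ((0 : ℤ), (0 : ℤ), (1 : ℤ)) then
        (if (i₁ = 0 ∧ i₂ = 1) ∨ (i₁ = 1 ∧ i₂ = 0) then (if i₃ = 0 then u else if i₃ = 1 then v else 0) else 0)
      else if μ = ((1 : ℤ), (0 : ℤ), (0 : ℤ)) then
        (if i₁ = 0 ∧ i₂ = 1 ∧ i₃ = 0 then -u else if i₁ = 1 ∧ i₂ = 1 ∧ i₃ = 0 then -v else 0)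
      else if μ = ((0 : ℤ), (1 : ℤ), (0 : ℤ)) then
        (if i₁ = 1 ∧ i₂ = 0 ∧ i₃ = 0 then -u else if i₁ = 1 ∧ i₂ = 1 ∧ i₃ = 0 then -v else 0) else 0) X₀) :
    ∃ (T : ℝ) (X : Fin 4 → ℤ → ℝ → ℝ), 0 < T ∧
      (∀ i n, X i n 0 = if n = 0 then X₀ i else 0) ∧ (∀ i n t, n < 0 → X i n t = 0) ∧
      (∀ i k, ∀ τ ∈ Ico (0 : ℝ) T, HasDerivWithinAt (X i k) (quadTerm ε₀ (fun (i₁ i₂ i₃ : Fin 4) (μ : ℤ × ℤ × ℤ) => if μ = ((0 : ℤ), (0 : ℤ), (1 : ℤ)) then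
        (if (i₁ = 0 ∧ i₂ = 1) ∨ (i₁ = 1 ∧ i₂ = 0) then (if i₃ = 0 then u else if i₃ = 1 then v else 0) else 0)
      else if μ = ((1 : ℤ), (0 : ℤ), (0 : ℤ)) then
        (if i₁ = 0 ∧ i₂ = 1 ∧ i₃ = 0 then -u else if i₁ = 1 ∧ i₂ = 1 ∧ i₃ = 0 then -v else 0)
      else if μ = ((0 : ℤ), (1 : ℤ), (0 : ℤ)) then
        (if i₁ = 1 ∧ i₂ = 0 ∧ i₃ = 0 then -u else if i₁ = 1 ∧ i₂ = 1 ∧ i₃ = 0 then -v else 0) else 0) X i k τ) (Ici 0) τ) ∧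
      ∀ k : ℕ, 1 ≤ k → ∃ t : ℝ, 0 ≤ t ∧ t < T ∧
        1 < fluxConst (fun (i₁ i₂ i₃ : Fin 4) (μ : ℤ × ℤ × ℤ) => if μ = ((0 : ℤ), (0 : ℤ), (1 : ℤ)) then
        (if (i₁ = 0 ∧ i₂ = 1) ∨ (i₁ = 1 ∧ i₂ = 0) then (if i₃ = 0 then u else if i₃ = 1 then v else 0) else 0)
      else if μ = ((1 : ℤ), (0 : ℤ), (0 : ℤ)) then
        (if i₁ = 0 ∧ i₂ = 1 ∧ i₃ = 0 then -u else if i₁ = 1 ∧ i₂ = 1 ∧ i₃ = 0 then -v else 0)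
      else if μ = ((0 : ℤ), (1 : ℤ), (0 : ℤ)) then
        (if i₁ = 1 ∧ i₂ = 0 ∧ i₃ = 0 then -u else if i₁ = 1 ∧ i₂ = 1 ∧ i₃ = 0 then -v else 0) else 0) * T * bigLam ε₀ ^ (k + 2) *
          (2 * |u / v| * Real.sqrt (u ^ 2 + v ^ 2) * bigLam ε₀ ^ (k : ℤ) * ∫ s in (0 : ℝ)..t, X 1 k s ^ 2) := by
  have hvne : v ≠ 0 := abs_pos.1 hv
  -- `M(u,v) ∈ E₂(R)` with `R = max |u|⁻¹ |v|⁻¹`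
  have hα : InTableClass (max |u|⁻¹ |v|⁻¹) (fun (i₁ i₂ i₃ : Fin 4) (μ : ℤ × ℤ × ℤ) => if μ = ((0 : ℤ), (0 : ℤ), (1 : ℤ)) then
        (if (i₁ = 0 ∧ i₂ = 1) ∨ (i₁ = 1 ∧ i₂ = 0) then (if i₃ = 0 then u else if i₃ = 1 then v else 0) else 0)
      else if μ = ((1 : ℤ), (0 : ℤ), (0 : ℤ)) then
        (if i₁ = 0 ∧ i₂ = 1 ∧ i₃ = 0 then -u else if i₁ = 1 ∧ i₂ = 1 ∧ i₃ = 0 then -v else 0)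
      else if μ = ((0 : ℤ), (1 : ℤ), (0 : ℤ)) then
        (if i₁ = 1 ∧ i₂ = 0 ∧ i₃ = 0 then -u else if i₁ = 1 ∧ i₂ = 1 ∧ i₃ = 0 then -v else 0) else 0) := by
    refine inTableClass_mixedDrainPair ?_ hu1 ?_ hv1
    · calc (max |u|⁻¹ |v|⁻¹)⁻¹ ≤ (|u|⁻¹)⁻¹ := inv_anti₀ (inv_pos.2 hu) (le_max_left _ _)
        _ = |u| := inv_inv |u|
    · calc (max |u|⁻¹ |v|⁻¹)⁻¹ ≤ (|v|⁻¹)⁻¹ := inv_anti₀ (inv_pos.2 hv) (le_max_right _ _)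
        _ = |v| := inv_inv |v|
  obtain ⟨T, X, hT, h1, h2, h3, h4, h5, hfire, -⟩ := everyShellFires_of_noGlobalCascade hε hα hNG
  have hder : ∀ i k, ∀ τ ∈ Ico (0 : ℝ) T,
      HasDerivWithinAt (X i k) (quadTerm ε₀ (fun (i₁ i₂ i₃ : Fin 4) (μ : ℤ × ℤ × ℤ) => if μ = ((0 : ℤ), (0 : ℤ), (1 : ℤ)) then
        (if (i₁ = 0 ∧ i₂ = 1) ∨ (i₁ = 1 ∧ i₂ = 0) then (if i₃ = 0 then u else if i₃ = 1 then v else 0) else 0)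
      else if μ = ((1 : ℤ), (0 : ℤ), (0 : ℤ)) then
        (if i₁ = 0 ∧ i₂ = 1 ∧ i₃ = 0 then -u else if i₁ = 1 ∧ i₂ = 1 ∧ i₃ = 0 then -v else 0)
      else if μ = ((0 : ℤ), (1 : ℤ), (0 : ℤ)) then
        (if i₁ = 1 ∧ i₂ = 0 ∧ i₃ = 0 then -u else if i₁ = 1 ∧ i₂ = 1 ∧ i₃ = 0 then -v else 0) else 0) X i k τ) (Ici 0) τ := by
    intro i k τ hτ
    have hd : DifferentiableWithinAt ℝ (X i k) (Ico 0 T) τ :=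
      ((h1 i k).differentiableOn one_ne_zero) τ hτ
    have hd' : DifferentiableWithinAt ℝ (X i k) (Ici 0) τ :=
      hd.mono_of_mem_nhdsWithin (by
        rw [mem_nhdsWithin]
        exact ⟨Iio T, isOpen_Iio, hτ.2, fun x hx => ⟨hx.2, hx.1⟩⟩)
    rw [← h4 i k τ hτ.1 hτ.2]
    exact hd'.hasDerivWithinAt
  have hreg : ∀ T' : ℝ, T' < T → ∃ M : ℝ, ∀ τ ∈ Icc (0 : ℝ) T', ∀ (i : Fin 4) (k : ℤ),
      (1 + (1 + ε₀) ^ ((10 : ℝ) * k)) * |X i k τ| ≤ M := by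
    intro T' hT'
    rcases le_or_gt T' 0 with h0 | h0
    · obtain ⟨M, hM⟩ := h5 (T / 2) (by linarith) (by linarith)
      exact ⟨M, fun τ hτ i k => hM τ hτ.1 (by linarith [hτ.2]) i k⟩
    · obtain ⟨M, hM⟩ := h5 T' h0 hT'
      exact ⟨M, fun τ hτ i k => hM τ hτ.1 hτ.2 i k⟩
  refine ⟨T, X, hT, h2, h3, hder, fun k hk => ?_⟩
  obtain ⟨t, ht0, htT, hlt⟩ := hfire (k + 1)
  refine ⟨t, ht0, htT, ?_⟩
  have hx := norm_shellVec_succ_le_wakeIntegral_mixedDrainPair hvne hε hder h2 h3 hreg hk ⟨ht0, htT⟩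
  have hcast : ((k + 1 : ℕ) : ℤ) = (k : ℤ) + 1 := by push_cast; ring
  rw [hcast] at hlt
  have hL : 0 < bigLam ε₀ := bigLam_pos (by linarith)
  have hC : 0 ≤ fluxConst (fun (i₁ i₂ i₃ : Fin 4) (μ : ℤ × ℤ × ℤ) => if μ = ((0 : ℤ), (0 : ℤ), (1 : ℤ)) then
        (if (i₁ = 0 ∧ i₂ = 1) ∨ (i₁ = 1 ∧ i₂ = 0) then (if i₃ = 0 then u else if i₃ = 1 then v else 0) else 0)
      else if μ = ((1 : ℤ), (0 : ℤ), (0 : ℤ)) then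
        (if i₁ = 0 ∧ i₂ = 1 ∧ i₃ = 0 then -u else if i₁ = 1 ∧ i₂ = 1 ∧ i₃ = 0 then -v else 0)
      else if μ = ((0 : ℤ), (1 : ℤ), (0 : ℤ)) then
        (if i₁ = 1 ∧ i₂ = 0 ∧ i₃ = 0 then -u else if i₁ = 1 ∧ i₂ = 1 ∧ i₃ = 0 then -v else 0) else 0) := by
    unfold fluxConst; positivity
  have hP : 0 ≤ fluxConst (fun (i₁ i₂ i₃ : Fin 4) (μ : ℤ × ℤ × ℤ) => if μ = ((0 : ℤ), (0 : ℤ), (1 : ℤ)) then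
        (if (i₁ = 0 ∧ i₂ = 1) ∨ (i₁ = 1 ∧ i₂ = 0) then (if i₃ = 0 then u else if i₃ = 1 then v else 0) else 0)
      else if μ = ((1 : ℤ), (0 : ℤ), (0 : ℤ)) then
        (if i₁ = 0 ∧ i₂ = 1 ∧ i₃ = 0 then -u else if i₁ = 1 ∧ i₂ = 1 ∧ i₃ = 0 then -v else 0)
      else if μ = ((0 : ℤ), (1 : ℤ), (0 : ℤ)) then
        (if i₁ = 1 ∧ i₂ = 0 ∧ i₃ = 0 then -u else if i₁ = 1 ∧ i₂ = 1 ∧ i₃ = 0 then -v else 0) else 0) * T * bigLam ε₀ ^ (k + 1 + 1) :=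
    mul_nonneg (mul_nonneg hC hT.le) (pow_pos hL _).le
  have hkk : k + 1 + 1 = k + 2 := by ring
  rw [hkk] at hlt hP
  exact lt_of_lt_of_le hlt (mul_le_mul_of_nonneg_left hx hP)

end BlowupRigidityOne

end Summit.NavierStokesRegularity.NavierStokesRegularity.Theorems

end
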